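import Summits.BirchSwinnertonDyer.BirchSwinnertonDyer.Theorems.SignedLowerHalvesSmallImageLowerHalfBothSignsRttD2SeqE2OfTwistCofree
import Summits.BirchSwinnertonDyer.BirchSwinnertonDyer.Theorems.SignedLowerHalvesSmallImageLowerHalfBothSignsRttD2SeqPlaceData
import HarnessLib

/-!
# Route `SignedLowerHalves`, crux L `SmallImageLowerHalfBothSigns` (stmt-BirchSwinnertonDyer-23599), line `rtt_w3` v14 → v15 — E2: E2 FROM ITS JUNCTION TAILS
# (the v15 composition BY NAME, shape of -w3 g20's `charRoad_E2_of_tails` p780953, with the research tail of RULING «U»)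

WHY (HELPER-TABLE addendum 10 «v15 PLAN»; LEAD `cruxlead-stmt-BirchSwinnertonDyer-23599` g11). v14's glue `charRoad_E2_of_tails` turns «∀ local choices, ∃ z hz Col c fv,
hc ∧ hfv ∧ hCol ∧ hK» into the E2-tail. After RULING «U» and the consumer chain p782277 → p782680 → p782740, the binder `hK` and the data `z hz` are THEOREMS of
the road-D frame + the junction; so the research tail becomes «∀ local choices, ∃ j₀ Col c fv, hc ∧ hfv ∧ hCol[z := j₀ (s ζ̄_a)] ∧ Function.Exact j₀ gX ∧ hY»,
with the frame (`b ∈ 𝔪`, φ, source skeleton `Dχ` + FACT-shape `Thm52Shape`, twist `σ`, target skeleton `Dθ`, semilinear `e₀ e₁ e₂`, `hH1`, `a`/`ha`, pins) and the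
junction carrier `B` with `s`, `htB`, `hcoker` as OUTER binders (they do not depend on the local choices). ★★★ `charRoad_E2_of_junction_tails`: CONCLUSION = the E2-tail of
`stub_charRoad_ns` for `Dψ.X` VERBATIM; proof = p780953's (the choices exist) then `charRoad_E2_of_roadD_junction_of_twist_cofree` (p782740). The v15 registry act
(LEAD) quantifies the outer binders over honda's NAMED structures (datum for χ₀ + FACT, `CycIwasawaCohomologyDataO` for `B`, the D-tw-coh equivalences) and uses this
theorem BY NAME.

THEOREMS ONLY (`--supports stmt-BirchSwinnertonDyer-23599` helper); closes nothing; crux L, crux M, E2 and BSD remain OPEN and are proved for NO curve by any of this.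
[cite: Kobayashi2003, Thm. 7.3 i), Thm. 1.3] [cite: JohnsonLeungKings2011, Thm. 5.2, Cor. 5.3] [cite: PollackRubin2004, §6–§7, Theorem (p. 448)] [cite: Rubin2000, Ch. VI §1–§2]
-/

set_option autoImplicit false
-- the Theorems namespace of this sub repeats the summit name by design (D-0017 nested layout)
set_option linter.dupNamespace false

noncomputable section

universe u

namespace Summit.BirchSwinnertonDyer.BirchSwinnertonDyer.Theorems.SmallImageRttD2Seq

open Literature.NumberTheory.EllipticCurves Literature.NumberTheory.EllipticCurves.Kobayashi2003
  Literature.NumberTheory.EllipticCurves.GreenbergVatsal2000 Literature.NumberTheory.GaloisRepresentations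
  Summit.BirchSwinnertonDyer.BirchSwinnertonDyer.Theorems.SmallImageCharSignedSelmer
  Literature.NumberTheory.ComplexMultiplication.EllipticUnits.JohnsonLeungKings2011
  Summit.BirchSwinnertonDyer.BirchSwinnertonDyer.Theorems.SmallImageRttD2Spec

section E2OfJunctionTails

open scoped MatrixGroups ModularForm
open PowerSeries Literature.NumberTheory.IwasawaTheory CongruenceSubgroup Rat.HeightOneSpectrum Literature.NumberTheory.EllipticCurves.ModularForms
  Summit.BirchSwinnertonDyer.BirchSwinnertonDyer.Theorems.SmallImageRttCharRoad NumberField IsDedekindDomain Field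

set_option maxHeartbeats 400000 in -- same budget line as p780454/p782277/p782680/p782740
/-- ★★★ **E2 FROM ITS JUNCTION TAILS — the v15 composition, in the stub's own binders.** As `charRoad_E2_of_tails` (p780953) with the v15 research tail:
for every local generator `γ_v`, local dual datum `DQ` and pinned `Λ_𝒪`-structures: `∃ j₀ : B →ₗ[Λ_𝒪] DQ.X` (J3, Poitou–Tate), `Col` (5′), `c ≠ 0`, `fv`, the explicit
reciprocity law `hCol` for `z := j₀ (s ζ̄_a)` (7′), `Function.Exact j₀ gX` (J3) and `hY` (J4); outer binders = the road-D frame of RULING «U» and the junction carrier with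
`sp¹` and its cokernel bound (J1/J2). CONCLUSION = the E2-tail of `stub_charRoad_ns` for `Dψ.X` VERBATIM. [cite: Kobayashi2003, Thm. 7.3 i), Thm. 1.3]
[cite: JohnsonLeungKings2011, Thm. 5.2, Cor. 5.3] [cite: PollackRubin2004, §6–§7] -/
theorem charRoad_E2_of_junction_tails {p : ℕ} [Fact p.Prime] (hp : p ≠ 2) {κ : ZpExtension ℚ p} (hκ : κ.IsCyclotomic)
    {K : Type} [Field K] [NumberField K] (hK2 : Module.finrank ℚ K = 2) (hnd : ¬ (p : ℤ) ∣ NumberField.discr K)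
    {v : HeightOneSpectrum (𝓞 K)} (hv : v.asIdeal = Ideal.span {((p : ℕ) : 𝓞 K)})
    (S : Set (PadicAlgCl p)) (hS : 0 < Module.finrank ℚ_[p] (padicCoeffField S)) [FiniteDimensional ℚ_[p] (padicCoeffField S)]
    [Algebra (IwasawaAlgebra p) (IwasawaAlgebraO S)]
    (halg : ∀ r : IwasawaAlgebra p, algebraMap (IwasawaAlgebra p) (IwasawaAlgebraO S) r = iwasawaToIwasawaO S r)
    (θ : FramedGaloisRep K (padicCoeffIntegers S) 1)
    [DistribMulAction (absoluteGaloisGroup (v.adicCompletion K)) (GreenbergSelmer.Cofree θ (padicCoeffField S))]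
    [SMulCommClass (absoluteGaloisGroup (v.adicCompletion K)) (padicCoeffIntegers S) (GreenbergSelmer.Cofree θ (padicCoeffField S))]
    (hres : ∀ (σ : absoluteGaloisGroup (v.adicCompletion K)) (m : GreenbergSelmer.Cofree θ (padicCoeffField S)),
      σ • m = resGalOfEmb (closureEmb (K := K) (v.adicCompletion K)) σ • m)
    (V : WeierstrassCurve K)
    (j : V.geomPrimaryTorsion p →+ GreenbergSelmer.Cofree θ (padicCoeffField S)) (S₀K : Set (HeightOneSpectrum (𝓞 K))) (ε : ℤˣ)
    {γK : absoluteGaloisGroup K} (hγK : (κ.restrictOfFinrankEqTwo hp K hK2).IsTopGenerator γK)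
    (D : SignedTransportDualDataSat (κ.restrictOfFinrankEqTwo hp K hK2) γK (GreenbergSelmer.Cofree θ (padicCoeffField S)) (padicCoeffIntegers S) V j S₀K ε)
    [Module.Finite (IwasawaAlgebra p) D.X] (hX : Module.IsTorsion (IwasawaAlgebra p) D.X)
    {N : ℕ} [NeZero N] (g : CuspForm (Gamma0 N) 2) (ι : coeffField g →+* PadicAlgCl p) (hng : IsNewform0 g)
    (S₀ : Finset (HeightOneSpectrum (𝓞 ℚ))) (L : IwasawaAlgebraO (Set.range ι)) (hL : L ≠ 0)
    [IsLocalRing (padicCoeffIntegers S)]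
    -- ROAD D (RULING «U»): `b ∈ 𝔪`, the inner evaluation `φ`, the source skeleton `Dχ` (finite-order `χ₀`, FACT) and its transport `Dθ` along `σ = Tw_η`
    (b : padicCoeffIntegers S) (hb : b ∈ IsLocalRing.maximalIdeal (padicCoeffIntegers S)) (φ : PowerSeries (IwasawaAlgebraO S) →+* IwasawaAlgebraO S)
    (hφf : φ (C (X - C b)) = 0) (hC : ∀ a : padicCoeffIntegers S, φ (C (C a)) = C a) (hφX : φ X = X)
    (hker : RingHom.ker φ = Ideal.span {C (X - C b)})
    {Aidx H0 H1 H2 : Type} [AddCommGroup H0] [Module (PowerSeries (IwasawaAlgebraO S)) H0] [AddCommGroup H1] [Module (PowerSeries (IwasawaAlgebraO S)) H1] [AddCommGroup H2] [Module (PowerSeries (IwasawaAlgebraO S)) H2]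
    {H0₀ H1₀ H2₀ : Type} [AddCommGroup H0₀] [Module (PowerSeries (IwasawaAlgebraO S)) H0₀] [AddCommGroup H1₀] [Module (PowerSeries (IwasawaAlgebraO S)) H1₀] [AddCommGroup H2₀] [Module (PowerSeries (IwasawaAlgebraO S)) H2₀]
    [Module.Finite (PowerSeries (IwasawaAlgebraO S)) H1₀] [Module.Finite (PowerSeries (IwasawaAlgebraO S)) H2₀]
    (Dχ : ZetaSkeleton (PowerSeries (IwasawaAlgebraO S)) Aidx H0₀ H1₀ H2₀) (h52χ : Dχ.Thm52Shape)
    (σ : PowerSeries (IwasawaAlgebraO S) ≃+* PowerSeries (IwasawaAlgebraO S))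
    (Dθ : ZetaSkeleton (PowerSeries (IwasawaAlgebraO S)) Aidx H0 H1 H2)
    (e₀ : H0₀ ≃+ H0) (e₁ : H1₀ ≃+ H1) (he₁ : ∀ (r : PowerSeries (IwasawaAlgebraO S)) (m : H1₀), e₁ (r • m) = σ r • e₁ m)
    (haZ : ∀ a : Aidx, e₁ (Dχ.aZeta a) = Dθ.aZeta a)
    (e₂ : H2₀ ≃+ H2) (he₂ : ∀ (r : PowerSeries (IwasawaAlgebraO S)) (m : H2₀), e₂ (r • m) = σ r • e₂ m)
    (hH1 : Submodule.torsionBy (PowerSeries (IwasawaAlgebraO S)) H1 (C (X - C b)) = ⊥) (a : Aidx) (ha : IsUnit (φ (Dθ.nsub a)))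
    [Module (IwasawaAlgebraO S) (QuotSMulTop (C (X - C b) : PowerSeries (IwasawaAlgebraO S)) H1)]
    (hιH : ∀ (l : IwasawaAlgebraO S) (x : QuotSMulTop (C (X - C b) : PowerSeries (IwasawaAlgebraO S)) H1),
      l • x = (PowerSeries.map (PowerSeries.C : padicCoeffIntegers S →+* IwasawaAlgebraO S) l) • x)
    [Module (IwasawaAlgebra p) (QuotSMulTop (C (X - C b) : PowerSeries (IwasawaAlgebraO S)) H1)]
    [IsScalarTower (IwasawaAlgebra p) (IwasawaAlgebraO S) (QuotSMulTop (C (X - C b) : PowerSeries (IwasawaAlgebraO S)) H1)]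
    [Module (IwasawaAlgebra p) (Submodule.torsionBy (PowerSeries (IwasawaAlgebraO S)) H2 (C (X - C b)))]
    (hΛT : ∀ (r : IwasawaAlgebra p) (x : Submodule.torsionBy (PowerSeries (IwasawaAlgebraO S)) H2 (C (X - C b))),
      r • x = (PowerSeries.map (PowerSeries.C : padicCoeffIntegers S →+* IwasawaAlgebraO S) (iwasawaToIwasawaO S r)) • x)
    [Module (IwasawaAlgebra p) (QuotSMulTop (C (X - C b) : PowerSeries (IwasawaAlgebraO S)) H2)]
    (hΛ2 : ∀ (r : IwasawaAlgebra p) (x : QuotSMulTop (C (X - C b) : PowerSeries (IwasawaAlgebraO S)) H2),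
      r • x = (PowerSeries.map (PowerSeries.C : padicCoeffIntegers S →+* IwasawaAlgebraO S) (iwasawaToIwasawaO S r)) • x)
    -- THE JUNCTION CARRIER `B` (J1) and the specialisation `s = sp¹` with its cokernel bound (J2)
    {B : Type} [AddCommGroup B] [Module (IwasawaAlgebraO S) B] [Module (IwasawaAlgebra p) B]
    [IsScalarTower (IwasawaAlgebra p) (IwasawaAlgebraO S) B]
    (s : QuotSMulTop (C (X - C b) : PowerSeries (IwasawaAlgebraO S)) H1 →ₗ[IwasawaAlgebraO S] B)
    [Module.Finite (IwasawaAlgebra p) (B ⧸ LinearMap.range s)] (htB : Module.IsTorsion (IwasawaAlgebra p) (B ⧸ LinearMap.range s))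
    (hcoker : lambdaInvariant p (B ⧸ LinearMap.range s) ≤ lambdaInvariant p (Submodule.torsionBy (PowerSeries (IwasawaAlgebraO S)) H2 (C (X - C b))))
    (tails : ∀ (γv : absoluteGaloisGroup (v.adicCompletion K))
        (hγv : (κ.restrictOfFinrankEqTwo hp K hK2).IsTopGenerator (resGalOfEmb (closureEmb (K := K) (v.adicCompletion K)) γv))
        (DQ : LocalCondDualData (κ.restrictOfFinrankEqTwo hp K hK2) (GreenbergSelmer.Cofree θ (padicCoeffField S)) (padicCoeffIntegers S) V j ε v γv)
        (instX : Module (IwasawaAlgebraO S) D.X) (instQ : Module (IwasawaAlgebraO S) DQ.X)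
        (hιX : ∀ (f : IwasawaAlgebra p) (x : D.X), (letI := instX; iwasawaToIwasawaO S f • x) = f • x)
        (hιQ : ∀ (f : IwasawaAlgebra p) (x : DQ.X), (letI := instQ; iwasawaToIwasawaO S f • x) = f • x)
        (hCX : ∀ (a : padicCoeffIntegers S) (x : D.X)
            (s : signedTransportSelmerInftySat (κ.restrictOfFinrankEqTwo hp K hK2) (GreenbergSelmer.Cofree θ (padicCoeffField S))
              (padicCoeffIntegers S) V j S₀K ε),
          D.toDual (letI := instX; (PowerSeries.C a : IwasawaAlgebraO S) • x) s =
            D.toDual x ⟨GreenbergSelmer.scalarH1 _ _ a s, scalarH1_mem_signedTransportSelmerInftySat _ _ (padicCoeffIntegers S) V j S₀K ε a s.2⟩)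
        (hCQ : ∀ (a : padicCoeffIntegers S) (x : DQ.X)
            (c : localCondInftySat (κ.restrictOfFinrankEqTwo hp K hK2) (GreenbergSelmer.Cofree θ (padicCoeffField S)) (padicCoeffIntegers S) V j ε v),
          DQ.toDual (letI := instQ; (PowerSeries.C a : IwasawaAlgebraO S) • x) c =
            DQ.toDual x (scalarLocalSat _ _ (padicCoeffIntegers S) V j ε v a c)),
        letI := instX; letI := instQ
        haveI : IsScalarTower (IwasawaAlgebra p) (IwasawaAlgebraO S) D.X := isScalarTower_iwasawaAlgebraO_of_smul_eq S halg hιX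
        haveI : IsScalarTower (IwasawaAlgebra p) (IwasawaAlgebraO S) DQ.X := isScalarTower_iwasawaAlgebraO_of_smul_eq S halg hιQ
        ∃ (j₀ : B →ₗ[IwasawaAlgebraO S] DQ.X) (Col : DQ.X ≃ₗ[IwasawaAlgebraO S] IwasawaAlgebraO S) (c : PadicAlgCl p)
          (fv : HeightOneSpectrum (𝓞 ℚ) → ℤ_[p]),
          c ≠ 0 ∧ (∀ w ∈ S₀, fv w ≠ 0 ∧ (fv w).valuation = (frobeniusExponent p (natGenerator w : ℤ_[p])).valuation) ∧
          iwasawaOToPowerSeries S (Col (j₀ (s (zetaSp (C (X - C b) : PowerSeries (IwasawaAlgebraO S)) Dθ a)))) =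
            PowerSeries.C c * iwasawaOToPowerSeries (Set.range ι) L *
              ∏ w ∈ S₀, Polynomial.aeval (PowerSeries.C ((natGenerator w : PadicAlgCl p)⁻¹) *
                  (PowerSeries.binomialSeries ℤ_[p] (fv w)).map (algebraMap ℤ_[p] (PadicAlgCl p)))
                (1 - Polynomial.C (embCoeff g ι (natGenerator w)) * Polynomial.X +
                  (if natGenerator w ∣ N then 0 else Polynomial.C (natGenerator w : PadicAlgCl p)) * Polynomial.X ^ 2) ∧
          let gX := gXLinearMapO S D DQ hres (natCast_mem_asIdeal_of_eq_span hv) instX instQ hιX hιQ hCX hCQ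
                (GreenbergSelmer.exists_pow_smul_cofree_eq_zero S θ) (GreenbergSelmer.isOpen_stabilizer_cofree S θ)
                (isOpen_stabilizer_of_hres (GreenbergSelmer.Cofree θ (padicCoeffField S)) v hres
                  (GreenbergSelmer.isOpen_stabilizer_cofree S θ)) hγK
                (isNonsplitIn_restrictOfFinrankEqTwo hp hκ K hK2 hnd (natCast_mem_asIdeal_of_eq_span hv)) hγv;
          Function.Exact j₀ gX ∧
            lambdaInvariant p (QuotSMulTop (C (X - C b) : PowerSeries (IwasawaAlgebraO S)) H2) ≤ lambdaInvariant p (D.X ⧸ LinearMap.range gX)) :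
    ∃ d : ℕ, (∀ k : ℕ, ‖PowerSeries.coeff k (iwasawaOToPowerSeries (Set.range ι) L)‖ ≤
        ‖PowerSeries.coeff d (iwasawaOToPowerSeries (Set.range ι) L)‖) ∧
      (∀ k : ℕ, k < d → ‖PowerSeries.coeff k (iwasawaOToPowerSeries (Set.range ι) L)‖ <
        ‖PowerSeries.coeff d (iwasawaOToPowerSeries (Set.range ι) L)‖) ∧
      Module.finrank ℚ_[p] (padicCoeffField S) * (d + ∑ w ∈ S₀, p ^ (frobeniusExponent p (natGenerator w : ℤ_[p])).valuation *
        layerLambda ((1 - Polynomial.C (embCoeff g ι (natGenerator w)) * Polynomial.X +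
          (if natGenerator w ∣ N then 0 else Polynomial.C (natGenerator w : PadicAlgCl p)) * Polynomial.X ^ 2).comp
            (Polynomial.C ((natGenerator w : PadicAlgCl p)⁻¹) * (Polynomial.X + 1)))) ≤ lambdaInvariant p D.X := by
  have hvp := natCast_mem_asIdeal_of_eq_span hv
  have hnon := isNonsplitIn_restrictOfFinrankEqTwo hp hκ K hK2 hnd hvp
  have htor := GreenbergSelmer.exists_pow_smul_cofree_eq_zero S θ
  have hstabK := GreenbergSelmer.isOpen_stabilizer_cofree S θ
  have hstab := isOpen_stabilizer_of_hres (GreenbergSelmer.Cofree θ (padicCoeffField S)) v hres hstabK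
  -- the auxiliary choices exist
  obtain ⟨γv, hγv⟩ := exists_localGenerator_restrictOfFinrankEqTwo hp hκ K hK2 hnd hvp
  obtain ⟨DQ⟩ := nonempty_localCondDualData_cofree' (V := V) (j := j) (ε := ε) hres hnon hγv
  obtain ⟨instX, hιX, hCX⟩ := exists_moduleO_signedTransportDualDataSat D htor hstabK hγK
  obtain ⟨instQ, hιQ, hCQ⟩ := DQ.exists_moduleO htor hstab hnon hγv
  -- the research inputs for these choices
  obtain ⟨j₀, Col, c, fv, hc, hfv, hCol, hexact, hY⟩ := tails γv hγv DQ instX instQ hιX hιQ hCX hCQ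
  exact charRoad_E2_of_roadD_junction_of_twist_cofree hres hS halg g ι hng S₀ D hX hγK hvp hnon hγv DQ instX instQ hιX hιQ hCX hCQ
    b hb φ hφf hC hφX hker Dχ h52χ σ Dθ e₀ e₁ he₁ haZ e₂ he₂ hH1 a ha hιH hΛT hΛ2 s htB hcoker j₀ hexact hY Col L hL hc fv hfv hCol

end E2OfJunctionTails

end Summit.BirchSwinnertonDyer.BirchSwinnertonDyer.Theorems.SmallImageRttD2Seq

end
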